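/-
HarnessLib.Audit — what TREE files import: the stable obligation-graph tag attributes only (`HarnessLib.Audit.Tags`).
The audit COMMANDS live in `HarnessLib.Audit.Check`, imported only by the gate's probe/scratch copies and the fixtures,
so that editing them never invalidates the Summits/Literature oleans downstream of the route files (split 2026-08-16).
-/
import HarnessLib.Audit.Tags
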